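import Summits.Ventures.HodgeRepro2.PeterssonCompactQuotient

/-!
# The Petersson product as a pre-inner-product space structure; Cauchy–Schwarz

Kernel support for the blind cell pub-hodge-repro2 (seat p2), T5-ID §ID-4(b′).  The continuous
weight-`k` functions for `S` form a `ℂ`-submodule `weightForms`; on a compact quotient, the Petersson
product against `quotientMeasure D` makes it a `PreInnerProductSpace.Core` in Mathlib's sense (hermitian,
sesquilinear — conjugate-linear in the FIRST slot, Mathlib's convention — and positive semi-definite), so
Mathlib's Cauchy–Schwarz inequality applies: `|⟨f, g⟩|² ≤ ⟨f, f⟩ ⟨g, g⟩`.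
-/

namespace Summit.Ventures.HodgeRepro2.ShimuraData

open MeasureTheory Complex

variable {K : Type*} [Field K] [NumberField K] [NumberField.IsCMField K]
    {τ₁ : K →+* ℂ} {H : Matrix (Fin 3) (Fin 3) K} {Q : Matrix (Fin 3) (Fin 3) ℂ}

section Submodule

variable (τ₁ : K →+* ℂ) (Q : Matrix (Fin 3) (Fin 3) ℂ) (S : Subgroup (GL (Fin 3) K)) (k : ℕ)

/-- The `ℂ`-subspace of continuous weight-`k` functions for `S`. -/
def weightForms : Submodule ℂ ((Fin 2 → ℂ) → ℂ) where
  carrier := {f | IsWeightFor τ₁ Q S k f ∧ ContinuousOn f ball₂}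
  zero_mem' := ⟨isWeightFor_zero, continuousOn_const⟩
  add_mem' := fun hf hg => ⟨hf.1.add hg.1, hf.2.add hg.2⟩
  smul_mem' := fun c _ hf => ⟨hf.1.smul c, hf.2.const_smul c⟩

omit [NumberField K] [NumberField.IsCMField K] in
/-- Membership in `weightForms`. -/
theorem mem_weightForms {f : (Fin 2 → ℂ) → ℂ} :
    f ∈ weightForms τ₁ Q S k ↔ IsWeightFor τ₁ Q S k f ∧ ContinuousOn f ball₂ := Iff.rfl

end Submodule

section Core

variable (hQ : IsFrame K τ₁ H Q) (S : Subgroup (GL (Fin 3) K))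
    (hS : (S : Set (GL (Fin 3) K)) ⊆ unitaryGroup K H) [CompactSpace (ballQuotient hQ S hS)]
    {D : Set ball₂} (k : ℕ)

/-- **The Petersson product is a pre-inner-product-space structure** on the continuous weight-`k` forms
(Mathlib's `PreInnerProductSpace.Core`: `inner x y := ⟨y, x⟩_Petersson`, conjugate-linear in `x`). -/
@[reducible] noncomputable def peterssonCore (hD : IsBallFundamentalDomain hQ S hS D) :
    PreInnerProductSpace.Core ℂ (weightForms τ₁ Q S k) where
  inner x y := peterssonInner hQ S hS (quotientMeasure hQ S hS D) y.property.1 x.property.1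
  conj_inner_symm x y := by
    show (starRingEnd ℂ) (peterssonInner hQ S hS (quotientMeasure hQ S hS D) x.property.1 y.property.1) =
      peterssonInner hQ S hS (quotientMeasure hQ S hS D) y.property.1 x.property.1
    rw [peterssonInner_swap hQ S hS _ x.property.1 y.property.1]
  re_inner_nonneg x := by
    show 0 ≤ RCLike.re (peterssonInner hQ S hS (quotientMeasure hQ S hS D) x.property.1 x.property.1)
    rw [peterssonInner_self]
    simp only [RCLike.re_to_complex, Complex.ofReal_re]
    exact integral_nonneg (peterssonQuotient_nonneg hQ S hS x.property.1)
  add_left x y z := by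
    haveI := isFiniteMeasure_quotientMeasure_of_compactSpace hQ S hS hD
    show peterssonInner hQ S hS (quotientMeasure hQ S hS D) z.property.1 (x + y).property.1 =
      peterssonInner hQ S hS (quotientMeasure hQ S hS D) z.property.1 x.property.1 +
        peterssonInner hQ S hS (quotientMeasure hQ S hS D) z.property.1 y.property.1
    exact peterssonInner_add_right hQ S hS _ z.property.1 x.property.1 y.property.1 z.property.2
      x.property.2 y.property.2
  smul_left x y r := by
    show peterssonInner hQ S hS (quotientMeasure hQ S hS D) y.property.1 (r • x).property.1 =
      (starRingEnd ℂ) r * peterssonInner hQ S hS (quotientMeasure hQ S hS D) y.property.1 x.property.1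
    exact peterssonInner_smul_right hQ S hS _ r y.property.1 x.property.1

/-- **Cauchy–Schwarz for the Petersson product** on a compact quotient:
`|⟨f, g⟩|² ≤ ⟨f, f⟩ · ⟨g, g⟩` for continuous weight-`k` forms `f, g` for `S`. -/
theorem norm_peterssonInner_sq_le (hD : IsBallFundamentalDomain hQ S hS D) {f g : (Fin 2 → ℂ) → ℂ}
    (hf : IsWeightFor τ₁ Q S k f)
    (hg : IsWeightFor τ₁ Q S k g) (hfc : ContinuousOn f ball₂) (hgc : ContinuousOn g ball₂) :
    ‖peterssonInner hQ S hS (quotientMeasure hQ S hS D) hf hg‖ ^ 2 ≤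
      (peterssonInner hQ S hS (quotientMeasure hQ S hS D) hf hf).re *
        (peterssonInner hQ S hS (quotientMeasure hQ S hS D) hg hg).re := by
  letI c : PreInnerProductSpace.Core ℂ (weightForms τ₁ Q S k) := peterssonCore hQ S hS k hD
  letI : Inner ℂ (weightForms τ₁ Q S k) := c.toInner
  have key := InnerProductSpace.Core.inner_mul_inner_self_le (𝕜 := ℂ) (F := weightForms τ₁ Q S k)
    ⟨g, hg, hgc⟩ ⟨f, hf, hfc⟩
  have h1 : inner ℂ (⟨g, hg, hgc⟩ : weightForms τ₁ Q S k) ⟨f, hf, hfc⟩ =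
      peterssonInner hQ S hS (quotientMeasure hQ S hS D) hf hg := rfl
  have h2 : inner ℂ (⟨f, hf, hfc⟩ : weightForms τ₁ Q S k) ⟨g, hg, hgc⟩ =
      peterssonInner hQ S hS (quotientMeasure hQ S hS D) hg hf := rfl
  have h3 : inner ℂ (⟨g, hg, hgc⟩ : weightForms τ₁ Q S k) ⟨g, hg, hgc⟩ =
      peterssonInner hQ S hS (quotientMeasure hQ S hS D) hg hg := rfl
  have h4 : inner ℂ (⟨f, hf, hfc⟩ : weightForms τ₁ Q S k) ⟨f, hf, hfc⟩ =
      peterssonInner hQ S hS (quotientMeasure hQ S hS D) hf hf := rfl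
  rw [h1, h2, h3, h4, peterssonInner_swap hQ S hS _ hf hg, Complex.norm_conj] at key
  simp only [RCLike.re_to_complex] at key
  rw [pow_two, mul_comm ((peterssonInner hQ S hS (quotientMeasure hQ S hS D) hf hf).re)]
  exact key

end Core

end Summit.Ventures.HodgeRepro2.ShimuraData
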